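import Mathlib
import HarnessLib
import Summits.Ventures.LatticeQCDFlow.Exactness.WilsonUniformJitterHMC
import Summits.Ventures.LatticeQCDFlow.Exactness.SUNJitteredHMCFiguresOfMerit

/-!
# Figures of merit of the engine's jittered `SU(N)` HMC AS RUN with the uniform (atomless) `tau_jitter` law: every event a finite `τ_int`, geometric decorrelation, a finite `σ²_f`, certified burn-in — alone or followed by ANY exact step

HONEST FRAMING: exact (Metropolis-corrected) sampling algorithms for lattice gauge theory;
figures of merit are autocorrelation/cost numbers at stated couplings and volumes; no
continuum-physics claim.

Venture `LatticeQCDFlow` (cell pub-lqcd), topic `Exactness`, FANOUT row 9 (eng-latcore, GEN-24; the engine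
`latflow.core.hmc.HMC(f, β, 'leapfrog').trajectory(τ, nstep, tau_jitter = j)` — length `τ(1 + j(2u − 1))`,
`u ∼ U(0,1)` — and `updates.composite_sweep(f, β, 'hmc', n_or)`).  NEW WORK of the cell over GEN-24's
`WilsonUniformJitterHMC.lean` (`uniformJitterLaw`, `wilson_uniformJitterHMC_invariant`, `wilson_uniformJitterHMC_certificate`,
`wilson_uniformJitterHMC_exactStep_certificate`), GEN-23's `SUNJitteredHMCFiguresOfMerit.lean` (the ATOM version, whose
shape this file repeats word for word; `doeblinConst_nonneg`), row 13's `NCMCGeneralSpaceDoeblinPower.lean`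
(`tauInt_setACF_le_of_nHit`, `abs_setAutocov_le_of_nHit`, `chain_timeAverage_bias_le_of_nHit`, `minorised_setwise`) and
row 8's `Scoring/DoeblinPowerBatchMeans.lean` (`greenKubo_nonneg_of_nHit`, `greenKubo_le_of_nHit`).  Nothing is cited
as a fact; no number is claimed.

THE DIFFERENCE FROM GEN-23: the hypothesis is no longer an ATOM of the jitter law (for the code's 53-bit uniform the
constant carried `2⁻⁵³`; the idealised law has none) but the engine's actual parameters: `nstep ≥ 1`, production
length `τ > 0`, jitter `0 < j ≤ 1` with `τ(1 − j) < τ₀` — e.g. `j = 1` at EVERY `τ`.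

## Content (`K = wilsonJitterHMCL N d L β nstep (uniformJitterLaw τ j)`, `π = wilsonMeasure (β/N)`; every theorem:
## `∃ τ₀ > 0` on `N, d, L, β` only, then for EVERY `nstep ≥ 1`, `τ > 0`, `0 < j ≤ 1` with `τ(1 − j) < τ₀`)

* §1 IN EQUILIBRIUM: **`wilson_uniformJitterHMC_tauInt_setACF_le`** — ONE `B ≥ 0` with
  `τ_int(1_A) ≤ 1/2 + B/(1 − π(A))` for EVERY measurable `A` with `0 < π(A) < 1`;
  **`wilson_uniformJitterHMC_abs_setAutocov_le`** — `|C_t(A, B)| ≤ π(A) r^{⌊t/m⌋}`;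
  **`wilson_uniformJitterHMC_greenKubo_le`** — `0 ≤ σ²_f ≤ V · C²` for EVERY bounded measurable `f`;
  **`wilson_uniformJitterHMC_exactStep_tauInt_setACF_le`** (with ANY `π`-invariant Markov step, e.g. `n_or × 'or'`).
* §2 FROM EVERY START: **`wilson_uniformJitterHMC_timeAverage_bias_le`** — certified burn-in `B/n`;
  **`wilson_uniformJitterHMC_exactStep_timeAverage_bias_le`**.

NOT CLAIMED: any value of `τ₀, B, r, m, V`; anything when `τ(1 − j) ≥ τ₀`; OMF words; floating point; unbounded
observables; CLT / batch means (`WilsonUniformJitterHMCErrorBars.lean`).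
-/

noncomputable section

namespace Summit.Ventures.LatticeQCDFlow.Exactness

open MeasureTheory ProbabilityTheory ProbabilityTheory.Kernel Set Function Filter Topology
open Literature.MathematicalPhysics.QuantumFieldTheory
open Literature.MathematicalPhysics.QuantumLattice (fundamentalRep continuous_fundamentalRep)
open scoped ENNReal Matrix Matrix.Norms.Operator NNReal

set_option backward.isDefEq.respectTransparency false

section FiguresOfMerit

variable {N d L : ℕ} [NeZero N] [NeZero L] (β : ℝ)

/-! ## §1 In equilibrium: every event has a finite `τ_int`, every bounded observable a finite `σ²_f` -/

/-- **EVERY EVENT HAS A FINITE INTEGRATED AUTOCORRELATION TIME UNDER THE ENGINE'S JITTERED `SU(N)` HMC AS RUN WITH THE UNIFORM `tau_jitter` LAW — ONE CONSTANT FOR ALL EVENTS** (scorers' `τ_int = 1/2 + Σ_{t≥1} ρ(t)`; `π = wilsonMeasure (β/N)`).  There is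
`τ₀ > 0` (on `N, d, L, β` only) such that for EVERY `nstep ≥ 1`, `τ > 0`, `0 < j ≤ 1` with `τ(1 − j) < τ₀`
there is `B ≥ 0` with `τ_int(1_A) ≤ 1/2 + B/(1 − π(A))` for EVERY measurable `A` with
`0 < π(A) < 1` — a topological sector, a plaquette bin, any event of the stationary chain. -/
theorem wilson_uniformJitterHMC_tauInt_setACF_le :
    ∃ τ₀ : ℝ, 0 < τ₀ ∧ ∀ (nstep : ℕ) (τ j : ℝ), 1 ≤ nstep → 0 < τ → 0 < j → j ≤ 1 → τ * (1 - j) < τ₀ →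
      ∃ B : ℝ, 0 ≤ B ∧ ∀ A : Set (GaugeConfig d L (Matrix.specialUnitaryGroup (Fin N) ℂ)), MeasurableSet A →
        0 < (wilsonMeasure (d := d) (L := L) (fundamentalRep (Fin N)) (β / N)).real A →
        (wilsonMeasure (d := d) (L := L) (fundamentalRep (Fin N)) (β / N)).real A < 1 →
        Scoring.tauInt (setACF (wilsonJitterHMCL N d L β nstep (uniformJitterLaw τ j))
            (wilsonMeasure (d := d) (L := L) (fundamentalRep (Fin N)) (β / N)) A) ≤
          1 / 2 + B / (1 - (wilsonMeasure (d := d) (L := L) (fundamentalRep (Fin N)) (β / N)).real A) := by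
  obtain ⟨τ₀, hτ₀, h⟩ := wilson_uniformJitterHMC_certificate (N := N) (d := d) (L := L) β
  refine ⟨τ₀, hτ₀, fun nstep τ j hn hτ hj hj1 hshort => ?_⟩
  obtain ⟨m, ε', hm, hε0, hε1, hmin⟩ := h nstep τ j hn hτ hj hj1 hshort
  refine ⟨(m : ℝ) / ε'.toReal - 1, doeblinConst_nonneg hm hε0 hε1, fun A hA h0 h1 => ?_⟩
  exact GeneralNCMC.tauInt_setACF_le_of_nHit (GeneralNCMC.minorised_setwise hmin) hε0 hε1 hm
    (wilson_uniformJitterHMC_invariant (N := N) (d := d) (L := L) β nstep τ j) hA h0 h1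

/-- **GEOMETRIC DECORRELATION OF EVENTS IN EQUILIBRIUM**: same `τ₀` and hypotheses; there are `m > 0` and
`r ∈ [0, 1)` with `|C_t(A, B)| = |π(U_0 ∈ A, U_t ∈ B) − π(A)π(B)| ≤ π(A) · r^{⌊t/m⌋}` for EVERY measurable `A, B`
and every `t`. -/
theorem wilson_uniformJitterHMC_abs_setAutocov_le :
    ∃ τ₀ : ℝ, 0 < τ₀ ∧ ∀ (nstep : ℕ) (τ j : ℝ), 1 ≤ nstep → 0 < τ → 0 < j → j ≤ 1 → τ * (1 - j) < τ₀ →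
      ∃ m : ℕ, ∃ r : ℝ, 0 < m ∧ 0 ≤ r ∧ r < 1 ∧
        ∀ (t : ℕ) (A B : Set (GaugeConfig d L (Matrix.specialUnitaryGroup (Fin N) ℂ))), MeasurableSet A → MeasurableSet B →
        |setAutocov (wilsonJitterHMCL N d L β nstep (uniformJitterLaw τ j)) (wilsonMeasure (d := d) (L := L) (fundamentalRep (Fin N)) (β / N)) t A B|
          ≤ (wilsonMeasure (d := d) (L := L) (fundamentalRep (Fin N)) (β / N)).real A * r ^ (t / m) := by
  obtain ⟨τ₀, hτ₀, h⟩ := wilson_uniformJitterHMC_certificate (N := N) (d := d) (L := L) β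
  refine ⟨τ₀, hτ₀, fun nstep τ j hn hτ hj hj1 hshort => ?_⟩
  obtain ⟨m, ε', hm, hε0, hε1, hmin⟩ := h nstep τ j hn hτ hj hj1 hshort
  have he0 : 0 < ε'.toReal := ENNReal.toReal_pos hε0.ne' (ne_top_of_le_ne_top ENNReal.one_ne_top hε1)
  have he1 : ε'.toReal ≤ 1 := ENNReal.toReal_le_of_le_ofReal zero_le_one (by simpa using hε1)
  refine ⟨m, 1 - ε'.toReal, hm, sub_nonneg.2 he1, sub_lt_self _ he0, fun t A B hA hB => ?_⟩
  exact GeneralNCMC.abs_setAutocov_le_of_nHit (GeneralNCMC.minorised_setwise hmin) hε1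
    (wilson_uniformJitterHMC_invariant (N := N) (d := d) (L := L) β nstep τ j) t hA hB

/-- **EVERY BOUNDED OBSERVABLE HAS A FINITE, NONNEGATIVE ASYMPTOTIC VARIANCE — ONE CONSTANT FOR ALL**: same `τ₀`
and hypotheses; there is `V ≥ 0` with `0 ≤ σ²_f ≤ V · C²` for EVERY measurable `f` with `|f| ≤ C`, where
`σ²_f = ∫ (f − πf)² dπ + 2 Σ_{k≥0} ∫ (f − πf) · K^{k+1}(f − πf) dπ` is the variance of `√n`-scaled time averages
(the Green–Kubo / `2 τ_int,f Var_π f` constant the scorers' error bars estimate). -/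
theorem wilson_uniformJitterHMC_greenKubo_le :
    ∃ τ₀ : ℝ, 0 < τ₀ ∧ ∀ (nstep : ℕ) (τ j : ℝ), 1 ≤ nstep → 0 < τ → 0 < j → j ≤ 1 → τ * (1 - j) < τ₀ →
      ∃ V : ℝ, 0 ≤ V ∧ ∀ (f : GaugeConfig d L (Matrix.specialUnitaryGroup (Fin N) ℂ) → ℝ), Measurable f →
        ∀ C : ℝ, (∀ U, |f U| ≤ C) →
        0 ≤ (∫ y, (f y - ∫ z, f z ∂(wilsonMeasure (d := d) (L := L) (fundamentalRep (Fin N)) (β / N))) ^ 2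
              ∂(wilsonMeasure (d := d) (L := L) (fundamentalRep (Fin N)) (β / N)))
            + 2 * ∑' k, ∫ y, (f y - ∫ z, f z ∂(wilsonMeasure (d := d) (L := L) (fundamentalRep (Fin N)) (β / N)))
              * (Scoring.kop (wilsonJitterHMCL N d L β nstep (uniformJitterLaw τ j)))^[k + 1]
                (fun y => f y - ∫ z, f z ∂(wilsonMeasure (d := d) (L := L) (fundamentalRep (Fin N)) (β / N))) y
              ∂(wilsonMeasure (d := d) (L := L) (fundamentalRep (Fin N)) (β / N)) ∧
        (∫ y, (f y - ∫ z, f z ∂(wilsonMeasure (d := d) (L := L) (fundamentalRep (Fin N)) (β / N))) ^ 2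
              ∂(wilsonMeasure (d := d) (L := L) (fundamentalRep (Fin N)) (β / N)))
            + 2 * ∑' k, ∫ y, (f y - ∫ z, f z ∂(wilsonMeasure (d := d) (L := L) (fundamentalRep (Fin N)) (β / N)))
              * (Scoring.kop (wilsonJitterHMCL N d L β nstep (uniformJitterLaw τ j)))^[k + 1]
                (fun y => f y - ∫ z, f z ∂(wilsonMeasure (d := d) (L := L) (fundamentalRep (Fin N)) (β / N))) y
              ∂(wilsonMeasure (d := d) (L := L) (fundamentalRep (Fin N)) (β / N))
          ≤ V * C ^ 2 := by
  obtain ⟨τ₀, hτ₀, h⟩ := wilson_uniformJitterHMC_certificate (N := N) (d := d) (L := L) β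
  refine ⟨τ₀, hτ₀, fun nstep τ j hn hτ hj hj1 hshort => ?_⟩
  obtain ⟨m, ε', hm, hε0, hε1, hmin⟩ := h nstep τ j hn hτ hj hj1 hshort
  set ρ : ℝ := 1 - ε'.toReal / ((m : ℝ) + 1)
  refine ⟨(4 * (ρ ^ m)⁻¹ / (1 - ρ)) ^ 2, sq_nonneg _, fun f hf C hC => ⟨?_, ?_⟩⟩
  · exact Scoring.greenKubo_nonneg_of_nHit (wilson_uniformJitterHMC_invariant (N := N) (d := d) (L := L) β nstep τ j)
      (GeneralNCMC.minorised_setwise hmin) hε0 hε1 hm hf hC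
  · calc _ ≤ (4 * C * (ρ ^ m)⁻¹ / (1 - ρ)) ^ 2 :=
          Scoring.greenKubo_le_of_nHit (wilson_uniformJitterHMC_invariant (N := N) (d := d) (L := L) β nstep τ j)
            (GeneralNCMC.minorised_setwise hmin) hε0 hε1 hm hf hC
      _ = (4 * (ρ ^ m)⁻¹ / (1 - ρ)) ^ 2 * C ^ 2 := by ring

/-- **THE SAME FOR THE JITTERED ENGINE HMC FOLLOWED BY ANY EXACT STEP** (e.g. the `'hmc' + n_or × 'or'`
composite): every event of the stationary composite chain has `τ_int(1_A) ≤ 1/2 + B/(1 − π(A))`, one `B ≥ 0`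
for all events. -/
theorem wilson_uniformJitterHMC_exactStep_tauInt_setACF_le :
    ∃ τ₀ : ℝ, 0 < τ₀ ∧ ∀ (nstep : ℕ) (τ j : ℝ), 1 ≤ nstep → 0 < τ → 0 < j → j ≤ 1 → τ * (1 - j) < τ₀ →
      ∀ (P : Kernel (GaugeConfig d L (Matrix.specialUnitaryGroup (Fin N) ℂ)) (GaugeConfig d L (Matrix.specialUnitaryGroup (Fin N) ℂ)))
        [IsMarkovKernel P], Invariant P (wilsonMeasure (d := d) (L := L) (fundamentalRep (Fin N)) (β / N)) →
      ∃ B : ℝ, 0 ≤ B ∧ ∀ A : Set (GaugeConfig d L (Matrix.specialUnitaryGroup (Fin N) ℂ)), MeasurableSet A →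
        0 < (wilsonMeasure (d := d) (L := L) (fundamentalRep (Fin N)) (β / N)).real A →
        (wilsonMeasure (d := d) (L := L) (fundamentalRep (Fin N)) (β / N)).real A < 1 →
        Scoring.tauInt (setACF (P ∘ₖ wilsonJitterHMCL N d L β nstep (uniformJitterLaw τ j))
            (wilsonMeasure (d := d) (L := L) (fundamentalRep (Fin N)) (β / N)) A) ≤
          1 / 2 + B / (1 - (wilsonMeasure (d := d) (L := L) (fundamentalRep (Fin N)) (β / N)).real A) := by
  obtain ⟨τ₀, hτ₀, h⟩ := wilson_uniformJitterHMC_exactStep_certificate (N := N) (d := d) (L := L) β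
  refine ⟨τ₀, hτ₀, fun nstep τ j hn hτ hj hj1 hshort P _ hP => ?_⟩
  obtain ⟨hinv, m, ε', hm, hε0, hε1, hmin⟩ := h nstep τ j hn hτ hj hj1 hshort P hP
  refine ⟨(m : ℝ) / ε'.toReal - 1, doeblinConst_nonneg hm hε0 hε1, fun A hA h0 h1 => ?_⟩
  exact GeneralNCMC.tauInt_setACF_le_of_nHit (GeneralNCMC.minorised_setwise hmin) hε0 hε1 hm hinv hA h0 h1

/-! ## §2 From every start: certified burn-in of time averages -/

/-- **CERTIFIED BURN-IN OF THE ENGINE'S JITTERED `SU(N)` HMC, FROM EVERY START — ONE CONSTANT FOR ALL RUNS.**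
Same `τ₀` and hypotheses; there is `B ≥ 0` such that for EVERY initial law `μ₀`, EVERY measurable `g` with
values in `[0, 1]` and EVERY run length `n ≥ 1`: `|E_{μ₀}[(1/n) Σ_{t<n} g(U_t)] − ∫ g dπ| ≤ B/n`,
`π = wilsonMeasure (β/N)` (the systematic error of a time average started out of equilibrium decays like `1/n`). -/
theorem wilson_uniformJitterHMC_timeAverage_bias_le :
    ∃ τ₀ : ℝ, 0 < τ₀ ∧ ∀ (nstep : ℕ) (τ j : ℝ), 1 ≤ nstep → 0 < τ → 0 < j → j ≤ 1 → τ * (1 - j) < τ₀ →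
      ∃ B : ℝ, 0 ≤ B ∧ ∀ (μ₀ : Measure (GaugeConfig d L (Matrix.specialUnitaryGroup (Fin N) ℂ))) [IsProbabilityMeasure μ₀]
        (g : GaugeConfig d L (Matrix.specialUnitaryGroup (Fin N) ℂ) → ℝ), Measurable g → (∀ U, 0 ≤ g U) → (∀ U, g U ≤ 1) →
        ∀ n : ℕ, n ≠ 0 →
        |∫ x, (∑ t ∈ Finset.range n, g (x t)) / n
            ∂(Kernel.trajMeasure (X := fun _ : ℕ => GaugeConfig d L (Matrix.specialUnitaryGroup (Fin N) ℂ)) μ₀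
              (fun t : ℕ => (wilsonJitterHMCL N d L β nstep (uniformJitterLaw τ j)).comap
                (fun h : (i : ↥(Finset.Iic t)) → GaugeConfig d L (Matrix.specialUnitaryGroup (Fin N) ℂ) =>
                  h ⟨t, Finset.mem_Iic.2 le_rfl⟩) (measurable_pi_apply _)))
          - ∫ U, g U ∂(wilsonMeasure (d := d) (L := L) (fundamentalRep (Fin N)) (β / N))| ≤ B / n := by
  obtain ⟨τ₀, hτ₀, h⟩ := wilson_uniformJitterHMC_certificate (N := N) (d := d) (L := L) β
  refine ⟨τ₀, hτ₀, fun nstep τ j hn hτ hj hj1 hshort => ?_⟩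
  obtain ⟨m, ε', hm, hε0, hε1, hmin⟩ := h nstep τ j hn hτ hj hj1 hshort
  have he0 : 0 < ε'.toReal := ENNReal.toReal_pos hε0.ne' (ne_top_of_le_ne_top ENNReal.one_ne_top hε1)
  refine ⟨(m : ℝ) / ε'.toReal, by positivity, fun μ₀ _ g hg h0 h1 n hn => ?_⟩
  calc _ ≤ (m : ℝ) / (ε'.toReal * n) :=
        GeneralNCMC.chain_timeAverage_bias_le_of_nHit (GeneralNCMC.minorised_setwise hmin) hε0 hε1 hm
          (wilson_uniformJitterHMC_invariant (N := N) (d := d) (L := L) β nstep τ j) μ₀ hg h0 h1 hn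
    _ = (m : ℝ) / ε'.toReal / n := by rw [div_div]

/-- **CERTIFIED BURN-IN OF THE JITTERED ENGINE HMC FOLLOWED BY ANY EXACT STEP** (e.g. `'hmc' + n_or × 'or'`):
one `B ≥ 0` with `|E_{μ₀}[(1/n) Σ_{t<n} g(U_t)] − ∫ g dπ| ≤ B/n` for every initial law, every `[0,1]`-valued
measurable `g`, every `n ≥ 1`. -/
theorem wilson_uniformJitterHMC_exactStep_timeAverage_bias_le :
    ∃ τ₀ : ℝ, 0 < τ₀ ∧ ∀ (nstep : ℕ) (τ j : ℝ), 1 ≤ nstep → 0 < τ → 0 < j → j ≤ 1 → τ * (1 - j) < τ₀ →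
      ∀ (P : Kernel (GaugeConfig d L (Matrix.specialUnitaryGroup (Fin N) ℂ)) (GaugeConfig d L (Matrix.specialUnitaryGroup (Fin N) ℂ)))
        [IsMarkovKernel P], Invariant P (wilsonMeasure (d := d) (L := L) (fundamentalRep (Fin N)) (β / N)) →
      ∃ B : ℝ, 0 ≤ B ∧ ∀ (μ₀ : Measure (GaugeConfig d L (Matrix.specialUnitaryGroup (Fin N) ℂ))) [IsProbabilityMeasure μ₀]
        (g : GaugeConfig d L (Matrix.specialUnitaryGroup (Fin N) ℂ) → ℝ), Measurable g → (∀ U, 0 ≤ g U) → (∀ U, g U ≤ 1) →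
        ∀ n : ℕ, n ≠ 0 →
        |∫ x, (∑ t ∈ Finset.range n, g (x t)) / n
            ∂(Kernel.trajMeasure (X := fun _ : ℕ => GaugeConfig d L (Matrix.specialUnitaryGroup (Fin N) ℂ)) μ₀
              (fun t : ℕ => (P ∘ₖ wilsonJitterHMCL N d L β nstep (uniformJitterLaw τ j)).comap
                (fun h : (i : ↥(Finset.Iic t)) → GaugeConfig d L (Matrix.specialUnitaryGroup (Fin N) ℂ) =>
                  h ⟨t, Finset.mem_Iic.2 le_rfl⟩) (measurable_pi_apply _)))
          - ∫ U, g U ∂(wilsonMeasure (d := d) (L := L) (fundamentalRep (Fin N)) (β / N))| ≤ B / n := by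
  obtain ⟨τ₀, hτ₀, h⟩ := wilson_uniformJitterHMC_exactStep_certificate (N := N) (d := d) (L := L) β
  refine ⟨τ₀, hτ₀, fun nstep τ j hn hτ hj hj1 hshort P _ hP => ?_⟩
  obtain ⟨hinv, m, ε', hm, hε0, hε1, hmin⟩ := h nstep τ j hn hτ hj hj1 hshort P hP
  have he0 : 0 < ε'.toReal := ENNReal.toReal_pos hε0.ne' (ne_top_of_le_ne_top ENNReal.one_ne_top hε1)
  refine ⟨(m : ℝ) / ε'.toReal, by positivity, fun μ₀ _ g hg h0 h1 n hn => ?_⟩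
  calc _ ≤ (m : ℝ) / (ε'.toReal * n) :=
        GeneralNCMC.chain_timeAverage_bias_le_of_nHit (GeneralNCMC.minorised_setwise hmin) hε0 hε1 hm
          hinv μ₀ hg h0 h1 hn
    _ = (m : ℝ) / ε'.toReal / n := by rw [div_div]

end FiguresOfMerit

end Summit.Ventures.LatticeQCDFlow.Exactness

end
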